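import Summits.CriticalPhenomena.Ising3D.OddTailConversionAlgebra
import Mathlib.Algebra.BigOperators.NatAntidiagonal
import Mathlib.Tactic.Linarith
import Mathlib.Tactic.Positivity
import Mathlib.Tactic.Ring
import Mathlib.Tactic.LinearCombination
import HarnessLib

/-!
# The first Legendre moment: `hMoment 1 j = j(j+1)/2`
(cell `pub-ising3x`, seat recog-1 gen 10; fixture for the `(E, h_k)`-polynomial form of the derivative-certificate
q-sums — `TaylorQSumMoments` / `TaylorOddConeEulerMajorant`: the `k = 1` moment as a polynomial in `J = j(j+1)`,
quoted in HOME/pub-ising3x-recog-1/gen9/G1-REDUCTION.md as `h_1 = J/2`)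

HONEST FRAMING: lottery ticket; floor = tightest certified 3D Ising CFT bounds; no exact-solution
claim without a proof.

With `λ_i = C(2i,i)/4^i` and the recurrence `(2i+2)λ_{i+1} = (2i+1)λ_i` (`legendreLam_succ_mul`):
`Σ_{p₁+p₂=j} λ_{p₁}λ_{p₂} p₁p₂ = j(j-1)/8` (two-step induction, peeling the `p₁ = 0` / `p₂ = 0` terms;
`sum_antidiagonal_lam_mul_mul`), hence with `Σ λλ = 1` (`sum_antidiagonal_legendreLam_mul`) and
`(p₁-p₂)² = j² - 4p₁p₂`: `hMoment 1 j = j(j+1)/2` (`hMoment_one`). Elementary.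
-/

namespace Summit.CriticalPhenomena.Ising3D

open Finset
open Literature.MathematicalPhysics.QuantumFieldTheory.ConformalBootstrap3D

/-- `(i+1) λ_{i+1} = (2i+1)/2 · λ_i`. [folklore] -/
theorem succ_mul_legendreLam_succ (i : ℕ) :
    ((i : ℝ) + 1) * legendreLam (i + 1) = (2 * (i : ℝ) + 1) / 2 * legendreLam i := by
  have h := legendreLam_succ_mul i
  linear_combination h / 2

/-- **`Σ_{p₁+p₂=j} λ_{p₁}λ_{p₂} p₁ p₂ = j(j-1)/8`.** [folklore] -/
theorem sum_antidiagonal_lam_mul_mul (j : ℕ) :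
    ∑ p ∈ antidiagonal j, legendreLam p.1 * legendreLam p.2 * ((p.1 : ℝ) * p.2) =
      (j : ℝ) * ((j : ℝ) - 1) / 8 := by
  induction j using Nat.twoStepInduction with
  | zero => simp
  | one =>
    rw [Nat.sum_antidiagonal_succ]
    simp
  | more j ih _ =>
    rw [Nat.sum_antidiagonal_succ, Nat.sum_antidiagonal_succ']
    have hterm : ∀ p : ℕ × ℕ,
        legendreLam (p.1 + 1) * legendreLam (p.2 + 1) * ((((p.1 + 1 : ℕ) : ℝ)) * (((p.2 + 1 : ℕ) : ℝ))) =
          legendreLam p.1 * legendreLam p.2 * ((p.1 : ℝ) * p.2) +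
            legendreLam p.1 * legendreLam p.2 * (((p.1 : ℝ) + p.2) / 2 + 1 / 4) := by
      intro p
      have h1 := succ_mul_legendreLam_succ p.1
      have h2 := succ_mul_legendreLam_succ p.2
      push_cast
      calc legendreLam (p.1 + 1) * legendreLam (p.2 + 1) * (((p.1 : ℝ) + 1) * ((p.2 : ℝ) + 1))
          = (((p.1 : ℝ) + 1) * legendreLam (p.1 + 1)) * (((p.2 : ℝ) + 1) * legendreLam (p.2 + 1)) := by ring
        _ = ((2 * (p.1 : ℝ) + 1) / 2 * legendreLam p.1) * ((2 * (p.2 : ℝ) + 1) / 2 * legendreLam p.2) := by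
            rw [h1, h2]
        _ = _ := by ring
    have hsum : ∑ p ∈ antidiagonal j,
        legendreLam (p.1 + 1) * legendreLam (p.2 + 1) * ((((p.1 + 1 : ℕ) : ℝ)) * (((p.2 + 1 : ℕ) : ℝ))) =
        (j : ℝ) * ((j : ℝ) - 1) / 8 + ((j : ℝ) / 2 + 1 / 4) := by
      rw [Finset.sum_congr rfl fun p _ => hterm p, Finset.sum_add_distrib, ih]
      congr 1
      calc ∑ p ∈ antidiagonal j, legendreLam p.1 * legendreLam p.2 * (((p.1 : ℝ) + p.2) / 2 + 1 / 4)
          = ∑ p ∈ antidiagonal j, legendreLam p.1 * legendreLam p.2 * ((j : ℝ) / 2 + 1 / 4) := by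
            refine Finset.sum_congr rfl fun p hp => ?_
            have : ((p.1 : ℝ) + p.2) = j := by exact_mod_cast mem_antidiagonal.mp hp
            rw [this]
        _ = (j : ℝ) / 2 + 1 / 4 := by rw [← Finset.sum_mul, sum_antidiagonal_legendreLam_mul, one_mul]
    simp only [Nat.cast_zero, mul_zero, zero_mul, zero_add]
    rw [hsum]
    push_cast
    ring

/-- **`hMoment 1 j = j(j+1)/2`** (`= J/2`, `J = j(j+1)`). [folklore] -/
theorem hMoment_one (j : ℕ) : hMoment 1 j = (j : ℝ) * ((j : ℝ) + 1) / 2 := by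
  have h1 := sum_antidiagonal_legendreLam_mul j
  have h2 := sum_antidiagonal_lam_mul_mul j
  have hsq : ∀ p ∈ antidiagonal j, legendreLam p.1 * legendreLam p.2 * ((p.1 : ℝ) - p.2) ^ (2 * 1) =
      (j : ℝ) ^ 2 * (legendreLam p.1 * legendreLam p.2) -
        4 * (legendreLam p.1 * legendreLam p.2 * ((p.1 : ℝ) * p.2)) := by
    intro p hp
    have : ((p.1 : ℝ) + p.2) = j := by exact_mod_cast mem_antidiagonal.mp hp
    rw [← this]
    ring
  unfold hMoment
  rw [Finset.sum_congr rfl hsq, Finset.sum_sub_distrib, ← Finset.mul_sum, ← Finset.mul_sum, h1, h2]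
  ring

end Summit.CriticalPhenomena.Ising3D
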